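import Mathlib
import Literature.NumberTheory.LFunctions.Zhang2022.Section13ZeroSumsPoly
import HarnessLib

/-!
# Zhang (2022) §13 p. 75, (13.11): the Z-POLY zero-side bounds packaged in the exact hypothesis shapes
# of the `𝔈`-assembler `Typed.Section13.frakE_le_of_zeroSum_bounds`

Topic `Literature/NumberTheory/LFunctions/Zhang2022` (Landau–Siegel audit tree; verdict-neutral).
Y. Zhang, *Discrete mean estimates and the Landau–Siegel zero*, arXiv:2211.02515v1 (2022)
[Zhang2022LandauSiegel], §13 p. 75 — an unrefereed manuscript under adjudication; nothing here asserts
its Theorems 1–2 or (13.11). ZHANG-L WP14, leaf `Skeleton.Eq1311Rel` (G-L3t6-3).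

`Section13ZeroSumsPoly` proves the five zero-side quadratic bounds for the short polynomial factors of
`𝔈` at a general purely imaginary shift `β`. The assembler (`Section13Eq1311Terms.frakE_le_of_zeroSum_bounds`,
hypotheses `hB, hN3B, hN3, hN2B, hD3, hD2`) consumes them at `β = β₃, β₂` and, for the `E₁`-polynomial,
at `β_j + iv` written as `ρ + β_j + v·I`. This file records `Re β_j = 0` (`β₁, β₂, β₃` of (2.13) are
purely imaginary), the `ρ + β + v·I` form of the `E₁`-row (uniform in `v`), and ONE existential package
`zeroSum_bounds_for_frakE_of_prop22` delivering the six hypotheses with a common constant.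

## References

* Y. Zhang, arXiv:2211.02515v1 (2022), §13 (13.3), (13.11) p. 75; §2 (2.13). [cite: Zhang2022LandauSiegel, §13 (13.11) p.75]
-/

noncomputable section

open Complex Real Finset Filter

namespace Literature.NumberTheory.LFunctions.Zhang2022.Typed.Section13

open Skeleton

variable {D : ℕ}

/-- `β₁, β₂, β₃` of (2.13) are purely imaginary. [cite: Zhang2022LandauSiegel, §2 (2.13) p.5] -/
theorem betaJ_re_eq_zero (c' : ℝ) (D : ℕ) :
    (beta1 c' D).re = 0 ∧ (beta2 c' D).re = 0 ∧ (beta3 c' D).re = 0 := by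
  refine ⟨?_, ?_, ?_⟩ <;> simp [beta1, beta2, beta3, Complex.mul_re, Complex.mul_im]

/-- **Z-POLY (`D_{T³}·B`) in the `ρ + β + v·I` form**: for `0 ≤ c′`, `Prop22 c′`: for all large `D`,
every `β` with `Re β = 0` and EVERY real `v`,
`ΣΣ w·|(Σ_{n<T³}ψ(n)n^{−(ρ+β+iv)})·B(ρ,ψ)|²·|ω| ≤ C·𝔓·𝓛⁵⁵` (uniform in `v`).
[cite: Zhang2022LandauSiegel, §13 (13.3), (13.11) p.75; §6 Lemma 6.1] -/
theorem zeroSum_E1poly_Bpoly_sq_le_of_prop22_shift {c' : ℝ} (hc' : 0 ≤ c') (h22 : Prop22 c') :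
    ∃ C : ℝ, 0 ≤ C ∧ ForAllLarge fun D _ χ => ∀ β : ℂ, β.re = 0 → ∀ v : ℝ,
      ∑ x ∈ finsetOf (PsiOne χ), ∑ ρ ∈ finsetOf (zeroSet D x),
          ‖x.ψ.LFunction (ρ + beta1 c' D) / deriv x.ψ.LFunction ρ‖ *
            ‖(∑ n ∈ Finset.Ico 1 ⌈bigT D ^ 3⌉₊, x.ψ (n : ZMod x.p) * (n : ℂ) ^ (-(ρ + β + v * I))) *
              Bpoly χ x ρ‖ ^ 2 * ‖omegaW D ρ‖ ≤ C * frakP D * ell D ^ 55 := by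
  obtain ⟨C, hC, D₀, h⟩ := zeroSum_E1poly_Bpoly_sq_le_of_prop22 hc' h22
  refine ⟨C, hC, D₀, fun D _ χ hD hq hp β hβ v => ?_⟩
  have h1 := h D χ hD hq hp (β + v * I) (by simp [hβ])
  simpa only [add_assoc] using h1

/-- **The six zero-side inputs of `frakE_le_of_zeroSum_bounds` with ONE constant** (`hB`, `hN3B`, `hN3`,
`hN2B`, `hD3`, `hD2` in its exact shapes; exponents `45, 55, 11, 55, 55, 55`), for `0 ≤ c′`, `Prop22 c′`.
[cite: Zhang2022LandauSiegel, §13 (13.11) p.75] -/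
theorem zeroSum_bounds_for_frakE_of_prop22 {c' : ℝ} (hc' : 0 ≤ c') (h22 : Prop22 c') :
    ∃ C : ℝ, 0 ≤ C ∧ ForAllLarge fun D _ χ =>
      (∑ x ∈ finsetOf (PsiOne χ), ∑ ρ ∈ finsetOf (zeroSet D x),
        ‖x.ψ.LFunction (ρ + beta1 c' D) / deriv x.ψ.LFunction ρ‖ * ‖Bpoly χ x ρ‖ ^ 2 * ‖omegaW D ρ‖ ≤
          C * frakP D * ell D ^ 45) ∧
      (∑ x ∈ finsetOf (PsiOne χ), ∑ ρ ∈ finsetOf (zeroSet D x),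
        ‖x.ψ.LFunction (ρ + beta1 c' D) / deriv x.ψ.LFunction ρ‖ *
          ‖Nchar D (psiFn x) (ρ + beta3 c' D) * Bpoly χ x ρ‖ ^ 2 * ‖omegaW D ρ‖ ≤ C * frakP D * ell D ^ 55) ∧
      (∑ x ∈ finsetOf (PsiOne χ), ∑ ρ ∈ finsetOf (zeroSet D x),
        ‖x.ψ.LFunction (ρ + beta1 c' D) / deriv x.ψ.LFunction ρ‖ *
          ‖Nchar D (psiFn x) (ρ + beta3 c' D)‖ ^ 2 * ‖omegaW D ρ‖ ≤ C * frakP D * ell D ^ 11) ∧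
      (∑ x ∈ finsetOf (PsiOne χ), ∑ ρ ∈ finsetOf (zeroSet D x),
        ‖x.ψ.LFunction (ρ + beta1 c' D) / deriv x.ψ.LFunction ρ‖ *
          ‖Nchar D (psiFn x) (ρ + beta2 c' D) * Bpoly χ x ρ‖ ^ 2 * ‖omegaW D ρ‖ ≤ C * frakP D * ell D ^ 55) ∧
      (∀ v : ℝ, |v| ≤ ell D ^ 20 → ∑ x ∈ finsetOf (PsiOne χ), ∑ ρ ∈ finsetOf (zeroSet D x),
        ‖x.ψ.LFunction (ρ + beta1 c' D) / deriv x.ψ.LFunction ρ‖ *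
          ‖(∑ n ∈ Finset.Ico 1 ⌈bigT D ^ 3⌉₊, x.ψ (n : ZMod x.p) * (n : ℂ) ^ (-(ρ + beta3 c' D + v * I))) *
            Bpoly χ x ρ‖ ^ 2 * ‖omegaW D ρ‖ ≤ C * frakP D * ell D ^ 55) ∧
      (∀ v : ℝ, |v| ≤ ell D ^ 20 → ∑ x ∈ finsetOf (PsiOne χ), ∑ ρ ∈ finsetOf (zeroSet D x),
        ‖x.ψ.LFunction (ρ + beta1 c' D) / deriv x.ψ.LFunction ρ‖ *
          ‖(∑ n ∈ Finset.Ico 1 ⌈bigT D ^ 3⌉₊, x.ψ (n : ZMod x.p) * (n : ℂ) ^ (-(ρ + beta2 c' D + v * I))) *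
            Bpoly χ x ρ‖ ^ 2 * ‖omegaW D ρ‖ ≤ C * frakP D * ell D ^ 55) := by
  obtain ⟨C₁, hC₁, D₁, h₁⟩ := zeroSum_Bpoly_sq_le_of_prop22 hc' h22
  obtain ⟨C₂, hC₂, D₂, h₂⟩ := zeroSum_Nchar_Bpoly_sq_le_of_prop22 hc' h22
  obtain ⟨C₃, hC₃, D₃, h₃⟩ := zeroSum_Nchar_sq_le_of_prop22 hc' h22
  obtain ⟨C₄, hC₄, D₄, h₄⟩ := zeroSum_E1poly_Bpoly_sq_le_of_prop22_shift hc' h22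
  set C := max (max C₁ C₂) (max C₃ C₄) with hCdef
  have hC1 : C₁ ≤ C := (le_max_left _ _).trans (le_max_left _ _)
  have hC2 : C₂ ≤ C := (le_max_right _ _).trans (le_max_left _ _)
  have hC3 : C₃ ≤ C := (le_max_left _ _).trans (le_max_right _ _)
  have hC4 : C₄ ≤ C := (le_max_right _ _).trans (le_max_right _ _)
  refine ⟨C, hC₁.trans hC1, max (max D₁ D₂) (max D₃ D₄), fun D _ χ hD hq hp => ?_⟩
  have hD1 : D₁ ≤ D := ((le_max_left _ _).trans (le_max_left _ _)).trans hD
  have hD2 : D₂ ≤ D := ((le_max_right _ _).trans (le_max_left _ _)).trans hD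
  have hD3 : D₃ ≤ D := ((le_max_left _ _).trans (le_max_right _ _)).trans hD
  have hD4 : D₄ ≤ D := ((le_max_right _ _).trans (le_max_right _ _)).trans hD
  obtain ⟨-, hb2, hb3⟩ := betaJ_re_eq_zero c' D
  have hP : 0 ≤ frakP D := by
    rw [frakP_eq_sum_primeWindow]; exact Finset.sum_nonneg fun p _ => Nat.cast_nonneg p
  have hℓ : 0 ≤ ell D := Real.log_natCast_nonneg D
  have mono : ∀ {X Cᵢ : ℝ} (k : ℕ), Cᵢ ≤ C → X ≤ Cᵢ * frakP D * ell D ^ k → X ≤ C * frakP D * ell D ^ k :=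
    fun k hle hX => hX.trans (by gcongr)
  exact ⟨mono 45 hC1 (h₁ D χ hD1 hq hp),
    mono 55 hC2 (h₂ D χ hD2 hq hp _ hb3),
    mono 11 hC3 (h₃ D χ hD3 hq hp _ hb3),
    mono 55 hC2 (h₂ D χ hD2 hq hp _ hb2),
    fun v _ => mono 55 hC4 (h₄ D χ hD4 hq hp _ hb3 v),
    fun v _ => mono 55 hC4 (h₄ D χ hD4 hq hp _ hb2 v)⟩

end Literature.NumberTheory.LFunctions.Zhang2022.Typed.Section13
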